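import Literature.MathematicalPhysics.QuantumFieldTheory.WilsonPlaquetteWeakCouplingFloorSU2
import Literature.MathematicalPhysics.QuantumFieldTheory.Balaban1983to89.InfiniteVolumeSufficientIII
import Literature.RepresentationTheory.CompactGroups.UnitaryTrick
import HarnessLib

/-!
# Robust ball (Y2), area-law side — THE FREE ENERGY AT EVERY COUPLING: the trivial ceiling and THE WEAK-COUPLING FLOOR

HONEST FRAMING: venture file of the cell `pub-ymgap` (QuantumFields programme), track ROBUST-BALL, seat rb-p2 (g7).  LATTICE statements about
the free energy density per site `f(β) = lim_L |Λ_L|⁻¹ log Z_{Λ_L, β}` (tree `freeEnergyDensity d ρ β`, Wave-0 normalisation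
`S = ∑_p (N − Re tr ρ(U_p)) ≥ 0`), complementing the strong-coupling law of `FreeEnergyLaw.lean` at the OTHER end of the coupling axis:
* `torusLogPartition_nonpos`, ★ `freeEnergyDensity_nonpos` — `f(β) ≤ 0` for `β ≥ 0` whenever `Re tr ρ ≤ N` (e.g. unitary `ρ`): the
  interaction pressure `f(β) + #planes·N·β` never exceeds its free value `#planes·N·β`;
* ★ `torusLogPartition_ge_linkBall`, ★★ `freeEnergyDensity_ge_linkBall` — THE WEAK-COUPLING FLOOR, every compact `G`, continuous unitary `ρ`,
  every `d`, `β ≥ 0`, `r > 0`: `f(β) ≥ −8·#planes·r²·β + d·log φ_ρ(r)`, `φ_ρ(r) = Haar{g : ‖ρ(g) − 1‖_F ≤ r}` (restriction of the Haar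
  integral to the link ball, where every plaquette costs `≤ 8r²` — the mechanism of the tree's `WilsonPlaquetteWeakCouplingFloor`, whose
  torus inequality `log Z ≥ −8βr²·#P + #E·log φ_ρ(r)` is re-derived here as a standalone statement and passed to the thermodynamic limit);
* ★★ `su2_freeEnergy_ge_weakCoupling_dim4` — `SU(2)`, `d = 4`, with the tree's small-ball estimate
  `haarProbability_real_ball_ge_su2` (`φ(r) ≥ r⁴/64` for `r² ≤ 1/2`, `WilsonPlaquetteWeakCouplingFloorSU2`) and `r² = 1/(3β_W)`:
  for every `β_W ≥ 2/3`,
  `f(β_W/2) ≥ −8 log β_W − (8 + 8 log 3 + 24 log 2)`, i.e. the interaction pressure `g(β_W) = f(β_W/2) + 6β_W` obeys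
  `6β_W − 8 log β_W − 33.4 ≤ g(β_W) ≤ 6β_W` — the correct weak-coupling SHAPE `#planes·N·β − O(log β)` (the true coefficient of `log β_W`
  is `−9/2`, Chatterjee 2016 for `U(N)`; the `8` is the link-ball artefact `d·(dim/…)` of the `r⁴` small-ball bound).
* `su2_freeEnergy_ge_weakCoupling_dim3` — `SU(2)`, `d = 3` (the `YM₃` lattices): `f(β_W/2) ≥ −6 log β_W − (6 + 24 log 2)` for `β_W ≥ 1`.
WHAT IT IS NOT: not Chatterjee's theorem (no matching upper bound `−c log β`); constants are artefacts; nothing continuum / spectral / Clay.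
0 compute.

References: S. Friedli, Y. Velenik (2017) Lemma 3.5, App. B.8.1 (pressure convexity, Jensen); S. Chatterjee, J. Funct. Anal. 271 (2016)
2944, Thm. 1.1 (the weak-coupling leading term, for comparison); R. Horn, C. Johnson, *Matrix Analysis* (2013) Thm. 2.2.2.  Everything here
is proved. [folklore]
-/

noncomputable section

open MeasureTheory Filter Topology
open scoped Matrix Matrix.Norms.Frobenius
open Literature.MathematicalPhysics.QuantumLattice
open Literature.MathematicalPhysics.QuantumFieldTheory hiding ZdEdge

namespace Summit.Ventures.YMGap.RobustBall

namespace FreeEnergyLaw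

section Generic

variable {d N : ℕ} {G : Type*} [Group G] [TopologicalSpace G] [IsTopologicalGroup G]
  [CompactSpace G] [MeasurableSpace G] [BorelSpace G] (ρ : G →* Matrix (Fin N) (Fin N) ℂ)

/-- `log Z_{Λ_L, β} ≤ 0` for `β ≥ 0` when `Re tr ρ ≤ N` (`S ≥ 0`, so `e^{−βS} ≤ 1` under the product Haar probability). [folklore] -/
theorem torusLogPartition_nonpos {L : ℕ} [NeZero L] (hρ : Continuous ρ) (hρN : ∀ g, (ρ g).trace.re ≤ N) {β : ℝ}
    (hβ : 0 ≤ β) : torusLogPartition d ρ β L ≤ 0 := by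
  haveI : IsProbabilityMeasure (Measure.pi fun _ : Edge d L => haarProbability G) := inferInstance
  rw [torusLogPartition_eq_log_integral ρ hρ β]
  refine Real.log_nonpos (integral_exp_neg_mul_wilsonAction_pos ρ hρ β).le ?_
  calc ∫ U, Real.exp (-β * wilsonAction ρ U) ∂(Measure.pi fun _ : Edge d L => haarProbability G)
      ≤ ∫ _U, (1 : ℝ) ∂(Measure.pi fun _ : Edge d L => haarProbability G) :=
        integral_mono (integrable_exp_mul_wilsonAction ρ hρ (-β) _) (integrable_const _) fun U => by
          rw [← Real.exp_zero]
          exact Real.exp_le_exp.2 (by nlinarith [wilsonAction_nonneg_of_re_trace_le (d := d) (L := L) ρ hρN U])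
    _ = 1 := by rw [integral_const, probReal_univ, one_smul]

/-- ★ **THE WEAK-COUPLING FLOOR for the torus log-partition function**: for continuous unitary `ρ`, `β ≥ 0`, `r > 0` and every
torus, `−β·8r²·#P + #E·log φ_ρ(r) ≤ log Z_{Λ_L, β}`, `φ_ρ(r) = Haar{‖ρ(g) − 1‖_F ≤ r}` (restrict the Haar integral to the link ball
`{‖ρ(U_e) − 1‖_F ≤ r ∀ e}`, on which `S ≤ 8r²·#P`; the torus inequality inside the tree's
`wilsonExpectation_wilsonAction_le_linkBall`, stated on its own). [folklore] -/
theorem torusLogPartition_ge_linkBall {L : ℕ} [NeZero L] (hρ : Continuous ρ) (hρU : ∀ g, ρ g ∈ Matrix.unitaryGroup (Fin N) ℂ)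
    {β : ℝ} (hβ : 0 ≤ β) {r : ℝ} (hr : 0 < r) :
    -(β * (8 * r ^ 2 * Fintype.card (Plaquette d L))) +
        Fintype.card (Edge d L) * Real.log ((haarProbability G).real {g : G | ‖ρ g - 1‖ ≤ r}) ≤
      torusLogPartition d ρ β L := by
  set π₀ : Measure (GaugeConfig d L G) := Measure.pi fun _ : Edge d L => haarProbability G with hπ₀
  set ε : ℝ := 8 * r ^ 2 * Fintype.card (Plaquette d L) with hε
  set φ : ℝ := (haarProbability G).real {g : G | ‖ρ g - 1‖ ≤ r} with hφ
  -- `φ > 0`: the ball contains an open neighbourhood of `1`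
  have hφpos : 0 < φ := by
    haveI : (haarProbability G).IsOpenPosMeasure := by unfold haarProbability; infer_instance
    have hopen : IsOpen {g : G | ‖ρ g - 1‖ < r} :=
      isOpen_lt (continuous_norm.comp (hρ.sub continuous_const)) continuous_const
    have hne : ({g : G | ‖ρ g - 1‖ < r}).Nonempty := ⟨1, by simpa using hr⟩
    have hpos := hopen.measure_pos (haarProbability G) hne
    have hsub : {g : G | ‖ρ g - 1‖ < r} ⊆ {g : G | ‖ρ g - 1‖ ≤ r} := fun g (hg : _ < r) => le_of_lt hg
    exact ENNReal.toReal_pos (ne_of_gt (hpos.trans_le (measure_mono hsub))) (measure_ne_top _ _)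
  -- product Haar measure of the link ball
  have hball : π₀.real {U : GaugeConfig d L G | ∀ e, ‖ρ (U e) - 1‖ ≤ r} = φ ^ Fintype.card (Edge d L) := by
    have hset : {U : GaugeConfig d L G | ∀ e, ‖ρ (U e) - 1‖ ≤ r} =
        Set.pi Set.univ fun _ : Edge d L => {g : G | ‖ρ g - 1‖ ≤ r} := by
      ext U; simp
    rw [measureReal_def, hset, hπ₀, Measure.pi_pi, Finset.prod_const, Finset.card_univ, ENNReal.toReal_pow,
      ← measureReal_def]
  -- `Z(β) ≥ e^{-βε} Haar^{⊗E}{S ≤ ε} ≥ e^{-βε} φ^{#E}`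
  have hZ1 := exp_mul_measureReal_le_integral_exp (d := d) (L := L) (G := G) ρ hρ hβ ε
  have hsub : {U : GaugeConfig d L G | ∀ e, ‖ρ (U e) - 1‖ ≤ r} ⊆ {U : GaugeConfig d L G | wilsonAction ρ U ≤ ε} :=
    fun U hU => wilsonAction_le_of_forall_norm_le ρ hρU hU
  have hmono : φ ^ Fintype.card (Edge d L) ≤ π₀.real {U : GaugeConfig d L G | wilsonAction ρ U ≤ ε} := by
    rw [← hball]; exact measureReal_mono hsub
  have hZ2 : Real.exp (-β * ε) * φ ^ Fintype.card (Edge d L) ≤ ∫ U, Real.exp (-β * wilsonAction ρ U) ∂π₀ :=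
    (mul_le_mul_of_nonneg_left hmono (Real.exp_pos _).le).trans hZ1
  have hpow : 0 < φ ^ Fintype.card (Edge d L) := pow_pos hφpos _
  have hlog : -β * ε + Fintype.card (Edge d L) * Real.log φ ≤ Real.log (∫ U, Real.exp (-β * wilsonAction ρ U) ∂π₀) := by
    have h := Real.log_le_log (mul_pos (Real.exp_pos _) hpow) hZ2
    rwa [Real.log_mul (Real.exp_pos _).ne' hpow.ne', Real.log_exp, Real.log_pow] at h
  rw [torusLogPartition_eq_log_integral ρ hρ β]
  have e : -(β * ε) = -β * ε := by ring
  rw [e]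
  exact hlog

variable [SecondCountableTopology G]

/-- ★ **`f(β) ≤ 0` for `β ≥ 0`** when `Re tr ρ ≤ N`: the interaction pressure `f(β) + #planes·N·β` never exceeds `#planes·N·β`.
[folklore] -/
theorem freeEnergyDensity_nonpos (hρ : Continuous ρ) (hρN : ∀ g, (ρ g).trace.re ≤ N) {β : ℝ} (hβ : 0 ≤ β) :
    freeEnergyDensity d ρ β ≤ 0 := by
  refine le_of_tendsto (hasFreeEnergyDensity_freeEnergyDensity ρ (exists_hasFreeEnergyDensity_holds (d := d) ρ hρ β))
    (Eventually.of_forall fun L => ?_)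
  exact mul_nonpos_of_nonneg_of_nonpos (by positivity) (torusLogPartition_nonpos (d := d) ρ hρ hρN hβ)

/-- ★★ **THE WEAK-COUPLING FLOOR OF THE FREE ENERGY DENSITY**: for every compact `G`, continuous unitary `ρ`, every `d`, `β ≥ 0` and
`r > 0`, `−8·#planes·r²·β + d·log φ_ρ(r) ≤ f(β)` (`#P = #planes·|Λ|`, `#E = d·|Λ|`). [folklore] -/
theorem freeEnergyDensity_ge_linkBall (hρ : Continuous ρ) (hρU : ∀ g, ρ g ∈ Matrix.unitaryGroup (Fin N) ℂ) {β : ℝ} (hβ : 0 ≤ β)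
    {r : ℝ} (hr : 0 < r) :
    -(8 * (Fintype.card {q : Fin d × Fin d // q.1 < q.2} : ℝ) * r ^ 2 * β) +
        d * Real.log ((haarProbability G).real {g : G | ‖ρ g - 1‖ ≤ r}) ≤ freeEnergyDensity d ρ β := by
  refine ge_of_tendsto (hasFreeEnergyDensity_freeEnergyDensity ρ (exists_hasFreeEnergyDensity_holds (d := d) ρ hρ β))
    (Eventually.of_forall fun L => ?_)
  have h := torusLogPartition_ge_linkBall (d := d) (L := L + 1) ρ hρ hρU hβ hr
  have hP : (Fintype.card (Plaquette d (L + 1)) : ℝ) =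
      ((L + 1 : ℕ) : ℝ) ^ d * (Fintype.card {q : Fin d × Fin d // q.1 < q.2} : ℝ) := by
    rw [Fintype.card_prod, Fintype.card_fun, ZMod.card, Fintype.card_fin]; push_cast; ring
  have hE : (Fintype.card (Edge d (L + 1)) : ℝ) = ((L + 1 : ℕ) : ℝ) ^ d * d := by
    rw [Fintype.card_prod, Fintype.card_fun, ZMod.card, Fintype.card_fin]; push_cast; ring
  rw [hP, hE] at h
  have hpow : 0 < (((L + 1 : ℕ) : ℝ) ^ d) := by positivity
  rw [show -(8 * (Fintype.card {q : Fin d × Fin d // q.1 < q.2} : ℝ) * r ^ 2 * β) +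
      (d : ℝ) * Real.log ((haarProbability G).real {g : G | ‖ρ g - 1‖ ≤ r}) =
      ((((L + 1 : ℕ) : ℝ) ^ d))⁻¹ * (-(β * (8 * r ^ 2 * (((L + 1 : ℕ) : ℝ) ^ d *
        (Fintype.card {q : Fin d × Fin d // q.1 < q.2} : ℝ)))) +
        ((L + 1 : ℕ) : ℝ) ^ d * d * Real.log ((haarProbability G).real {g : G | ‖ρ g - 1‖ ≤ r})) by
    field_simp]
  exact mul_le_mul_of_nonneg_left h (inv_nonneg.2 hpow.le)

end Generic

/-! ### `SU(2)`, `d = 4`: an explicit weak-coupling floor -/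

section SU2

/-- ★★ **SU(2), `d = 4`: THE WEAK-COUPLING FLOOR OF THE FREE ENERGY** — for every `β_W ≥ 2/3`,
`f(β_W/2) ≥ −8 log β_W − (8 + 8 log 3 + 24 log 2)`, i.e. the interaction pressure `g(β_W) = f(β_W/2) + 6β_W` obeys
`6β_W − 8 log β_W − 33.4 ≤ g(β_W) ≤ 6β_W` (`freeEnergyDensity_ge_linkBall` with `r² = 1/(3β_W)` and `haarProbability_real_ball_ge_su2`; the ceiling is
`freeEnergyDensity_nonpos`).  The SHAPE `6β_W − O(log β_W)` is the weak-coupling law's; the coefficient `8` and the constant are link-ball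
artefacts (truth: `9/2`, Chatterjee). [folklore] -/
theorem su2_freeEnergy_ge_weakCoupling_dim4 {βW : ℝ} (hβ : 2 / 3 ≤ βW) :
    -(8 * Real.log βW) - (8 + 8 * Real.log 3 + 24 * Real.log 2) ≤ freeEnergyDensity 4 (fundamentalRep (Fin 2)) (βW / 2) ∧
      freeEnergyDensity 4 (fundamentalRep (Fin 2)) (βW / 2) ≤ 0 := by
  have hβ0 : 0 < βW := by linarith
  have hρ := (TorusAreaLaw.isSpecialUnitaryModel_fundamentalRep 2).1
  have hρU : ∀ g : Matrix.specialUnitaryGroup (Fin 2) ℂ, fundamentalRep (Fin 2) g ∈ Matrix.unitaryGroup (Fin 2) ℂ :=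
    fun g => (Matrix.mem_specialUnitaryGroup_iff.1 g.2).1
  have hρN : ∀ g : Matrix.specialUnitaryGroup (Fin 2) ℂ, (fundamentalRep (Fin 2) g).trace.re ≤ (2 : ℕ) := fun g =>
    (abs_le.1 (Literature.RepresentationTheory.CompactGroups.CompactGroup.abs_re_trace_le_card (fundamentalRep (Fin 2)) hρ g)).2
  refine ⟨?_, freeEnergyDensity_nonpos (d := 4) _ hρ hρN (by positivity)⟩
  -- the link-ball floor at `r = (3β_W)^{-1/2}`
  set r : ℝ := Real.sqrt (1 / (3 * βW)) with hr
  have hr0 : 0 < r := Real.sqrt_pos.2 (by positivity)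
  have hr2 : r ^ 2 = 1 / (3 * βW) := by rw [hr, Real.sq_sqrt (by positivity)]
  have hr2le : r ^ 2 ≤ 1 / 2 := by
    rw [hr2, div_le_div_iff₀ (by positivity) (by norm_num)]; linarith
  have hfloor := freeEnergyDensity_ge_linkBall (d := 4) (fundamentalRep (Fin 2)) hρ hρU (by positivity : (0 : ℝ) ≤ βW / 2) hr0
  have hball := haarProbability_real_ball_ge_su2 hr0 hr2le
  have hD : (Fintype.card {q : Fin 4 × Fin 4 // q.1 < q.2} : ℝ) = 6 := by
    rw [show Fintype.card {q : Fin 4 × Fin 4 // q.1 < q.2} = 6 by rfl]; norm_num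
  rw [hD] at hfloor
  push_cast at hfloor
  -- `log φ ≥ log (r⁴/64) = 2 log r² − 6 log 2`
  have hr4 : 0 < r ^ 4 / 64 := by positivity
  have hlogφ : Real.log (r ^ 4 / 64) ≤
      Real.log ((haarProbability (Matrix.specialUnitaryGroup (Fin 2) ℂ)).real
        {g : Matrix.specialUnitaryGroup (Fin 2) ℂ | ‖fundamentalRep (Fin 2) g - 1‖ ≤ r}) :=
    Real.log_le_log hr4 hball
  have h64 : Real.log 64 = 6 * Real.log 2 := by
    rw [show (64 : ℝ) = 2 ^ 6 by norm_num, Real.log_pow]; push_cast; ring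
  have hr4' : Real.log (r ^ 4) = 2 * Real.log (r ^ 2) := by
    rw [show r ^ 4 = (r ^ 2) ^ 2 by ring, Real.log_pow]; push_cast; ring
  have hlog64 : Real.log (r ^ 4 / 64) = 2 * Real.log (r ^ 2) - 6 * Real.log 2 := by
    rw [Real.log_div (by positivity) (by norm_num), h64, hr4']
  have hlogr2 : Real.log (r ^ 2) = -(Real.log 3 + Real.log βW) := by
    rw [hr2, Real.log_div (by norm_num) (by positivity), Real.log_one, Real.log_mul (by norm_num) hβ0.ne']
    ring
  -- `−8·6·r²·(β_W/2) = −8`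
  have hlin : -(8 * (6 : ℝ) * r ^ 2 * (βW / 2)) = -8 := by
    rw [hr2]; field_simp; ring
  rw [hlin] at hfloor
  have : -(8 : ℝ) + 4 * (2 * -(Real.log 3 + Real.log βW) - 6 * Real.log 2) ≤
      freeEnergyDensity 4 (fundamentalRep (Fin 2)) (βW / 2) := by
    rw [← hlogr2, ← hlog64]
    linarith
  linarith

/-- ★ **SU(2), `d = 3`: the weak-coupling floor on the `YM₃` lattices** — for every `β_W ≥ 1`,
`f(β_W/2) ≥ −6 log β_W − (6 + 24 log 2)` (three planes, three links per site; `r² = 1/(2β_W)`), and `f(β_W/2) ≤ 0`; i.e. the interaction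
pressure `g(β_W) = f(β_W/2) + 3β_W` obeys `3β_W − 6 log β_W − 22.7 ≤ g(β_W) ≤ 3β_W`. [folklore] -/
theorem su2_freeEnergy_ge_weakCoupling_dim3 {βW : ℝ} (hβ : 1 ≤ βW) :
    -(6 * Real.log βW) - (6 + 24 * Real.log 2) ≤ freeEnergyDensity 3 (fundamentalRep (Fin 2)) (βW / 2) ∧
      freeEnergyDensity 3 (fundamentalRep (Fin 2)) (βW / 2) ≤ 0 := by
  have hβ0 : 0 < βW := by linarith
  have hρ := (TorusAreaLaw.isSpecialUnitaryModel_fundamentalRep 2).1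
  have hρU : ∀ g : Matrix.specialUnitaryGroup (Fin 2) ℂ, fundamentalRep (Fin 2) g ∈ Matrix.unitaryGroup (Fin 2) ℂ :=
    fun g => (Matrix.mem_specialUnitaryGroup_iff.1 g.2).1
  have hρN : ∀ g : Matrix.specialUnitaryGroup (Fin 2) ℂ, (fundamentalRep (Fin 2) g).trace.re ≤ (2 : ℕ) := fun g =>
    (abs_le.1 (Literature.RepresentationTheory.CompactGroups.CompactGroup.abs_re_trace_le_card (fundamentalRep (Fin 2)) hρ g)).2
  refine ⟨?_, freeEnergyDensity_nonpos (d := 3) _ hρ hρN (by positivity)⟩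
  set r : ℝ := Real.sqrt (1 / (2 * βW)) with hr
  have hr0 : 0 < r := Real.sqrt_pos.2 (by positivity)
  have hr2 : r ^ 2 = 1 / (2 * βW) := by rw [hr, Real.sq_sqrt (by positivity)]
  have hr2le : r ^ 2 ≤ 1 / 2 := by
    rw [hr2, div_le_div_iff₀ (by positivity) (by norm_num)]; linarith
  have hfloor := freeEnergyDensity_ge_linkBall (d := 3) (fundamentalRep (Fin 2)) hρ hρU (by positivity : (0 : ℝ) ≤ βW / 2) hr0
  have hball := haarProbability_real_ball_ge_su2 hr0 hr2le
  have hD : (Fintype.card {q : Fin 3 × Fin 3 // q.1 < q.2} : ℝ) = 3 := by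
    rw [show Fintype.card {q : Fin 3 × Fin 3 // q.1 < q.2} = 3 by rfl]; norm_num
  rw [hD] at hfloor
  push_cast at hfloor
  have hr4 : 0 < r ^ 4 / 64 := by positivity
  have hlogφ : Real.log (r ^ 4 / 64) ≤
      Real.log ((haarProbability (Matrix.specialUnitaryGroup (Fin 2) ℂ)).real
        {g : Matrix.specialUnitaryGroup (Fin 2) ℂ | ‖fundamentalRep (Fin 2) g - 1‖ ≤ r}) :=
    Real.log_le_log hr4 hball
  have h64 : Real.log 64 = 6 * Real.log 2 := by
    rw [show (64 : ℝ) = 2 ^ 6 by norm_num, Real.log_pow]; push_cast; ring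
  have hr4' : Real.log (r ^ 4) = 2 * Real.log (r ^ 2) := by
    rw [show r ^ 4 = (r ^ 2) ^ 2 by ring, Real.log_pow]; push_cast; ring
  have hlog64 : Real.log (r ^ 4 / 64) = 2 * Real.log (r ^ 2) - 6 * Real.log 2 := by
    rw [Real.log_div (by positivity) (by norm_num), h64, hr4']
  have hlogr2 : Real.log (r ^ 2) = -(Real.log 2 + Real.log βW) := by
    rw [hr2, Real.log_div (by norm_num) (by positivity), Real.log_one, Real.log_mul (by norm_num) hβ0.ne']
    ring
  have hlin : -(8 * (3 : ℝ) * r ^ 2 * (βW / 2)) = -6 := by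
    rw [hr2]; field_simp; ring
  rw [hlin] at hfloor
  have : -(6 : ℝ) + 3 * (2 * -(Real.log 2 + Real.log βW) - 6 * Real.log 2) ≤
      freeEnergyDensity 3 (fundamentalRep (Fin 2)) (βW / 2) := by
    rw [← hlogr2, ← hlog64]
    linarith
  linarith

end SU2

end FreeEnergyLaw

end Summit.Ventures.YMGap.RobustBall
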